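import Mathlib
import HarnessLib

/-!
# Existence of the scaling limit of the site-`𝕋` twisted nesting transform — part 1/2: the coupling estimate

Crux `Summit.CriticalPhenomena.CardyFormulaZ2.Theses.CardyMagicRigidity.MagicFormulaT`
(stmt-CriticalPhenomena-4836), line `Sketch`, skeleton v7 (lead c3): elementary lemmas and the abstract COUPLING ESTIMATE
`el_coupling_estimate` (registered sub-goal) used by the registered stub `stub_existsLimit` (part 2/2,
`CardyMagicRigidityMagicFormulaTExistsLimit.lean`).  Pure measure theory (Mathlib only).

Given (CN) Camia–Newman's full-plane CLE₆ limit in its Cauchy form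
(`exists_isFullPlaneCNLLaw.cnLawEDist_siteLoopConfig_le`: the laws of the loop configurations at two small
meshes are `d_CN`-close), (A) the a priori bounds of `stub_aprioriBounds` (uniform second moments of the
truncated weights, tightness of the number of relevant loops, window, thin sausages), (B) the deterministic
comparison `stub_closeComparison` of the THRESHOLD-AVERAGED big-loop weights of two `ε`-close ribbon-free
configurations, (R) the ribbon bound of `stub_ribbonRarity`, and the landed UV theorem
`smallLoops_negligible_site` (v6), the family `δ ↦ Λ^𝕋_δ(f) = truncNestingTransform P (siteLoopConfig δ) f 0`
is Cauchy as `δ → 0⁺`, hence converges (completeness of `ℝ`).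

Proof (`stub_existsLimit`).  Fix `κ > 0`, `κ₁ = κ/10`.  UV gives `η₀` with `|Λ_δ − Λ^{η'}_δ| ≤ κ₁` for all
`η' < η₀` and small `δ`; put `η = η₀/2` and average over the `m` thresholds `η_j = η/2 + (j+1)η/(2m) ∈ (η/2, η]`:
`|Λ_δ − Λ̄_δ| ≤ κ₁`.  For two meshes couple the configurations by a measure `Q` on `Ω × Ω` with marginals `P`
(CN, `exists_coupling_of_cnLawEDist_lt`); then `Λ̄_δ − Λ̄_{δ'} = ∫ (Ā_δ ∘ fst − Ā_{δ'} ∘ snd) dQ`.  On the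
complement of a measurable hull `Bad ⊇` {not `ε`-close} ∪ {marginal bad events} the integrand is `≤ κ₁` by (B);
on `Bad`, `|D| ≤ (t/2) D² + 1/(2t)` with `∫ D² ≤ 4B` by (A)(i) and `Q(Bad) ≤ p₀ = κ₁²/(2(4B+1))` by (A)(ii–iv),
(R) and the coupling (outer measure: `Measure.le_map_apply`), whence `∫_Bad |D| ≤ κ₁`.  Total `≤ 4κ₁ < κ`.
-/

noncomputable section

namespace Summit.CriticalPhenomena.CardyFormulaZ2.Cruxes.MagicFormulaT.LineSketch

open MeasureTheory Filter Set
open scoped Real Topology BigOperators ENNReal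

/-! ## Elementary lemmas -/

/-- A real function which is uniformly Cauchy on small right-neighbourhoods of `0` has a limit along `𝓝[>] 0`. -/
theorem el_exists_tendsto_of_cauchy (Λ : ℝ → ℝ)
    (h : ∀ κ : ℝ, 0 < κ → ∃ δ₀ : ℝ, 0 < δ₀ ∧ ∀ δ δ' : ℝ, 0 < δ → δ < δ₀ → 0 < δ' → δ' < δ₀ → |Λ δ - Λ δ'| ≤ κ) :
    ∃ L : ℝ, Tendsto Λ (𝓝[>] 0) (𝓝 L) := by
  rw [← cauchy_map_iff_exists_tendsto]
  refine Metric.cauchy_iff.2 ⟨Filter.map_neBot, fun e he ↦ ?_⟩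
  obtain ⟨δ₀, hδ₀, hδ⟩ := h (e / 2) (by positivity)
  refine ⟨Λ '' Ioo 0 δ₀, ?_, ?_⟩
  · exact Filter.image_mem_map (Ioo_mem_nhdsGT hδ₀)
  · rintro x ⟨δ, ⟨hδ1, hδ2⟩, rfl⟩ y ⟨δ', ⟨hδ'1, hδ'2⟩, rfl⟩
    rw [Real.dist_eq]
    exact (hδ δ δ' hδ1 hδ2 hδ'1 hδ'2).trans_lt (by linarith)

/-- From an eventuality along `𝓝[>] 0` extract an explicit interval `(0, δ₀)`. -/
theorem el_exists_Ioo_of_eventually {p : ℝ → Prop} (h : ∀ᶠ δ in 𝓝[>] (0 : ℝ), p δ) :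
    ∃ δ₀ : ℝ, 0 < δ₀ ∧ ∀ δ : ℝ, 0 < δ → δ < δ₀ → p δ := by
  obtain ⟨u, hu, hsub⟩ := mem_nhdsGT_iff_exists_Ioo_subset.1 h
  exact ⟨u, hu, fun δ h1 h2 ↦ hsub ⟨h1, h2⟩⟩

/-- Averaging: if `|x - a j| ≤ κ` for all `j < m` (`m ≥ 1`) then `|x - (∑ a j)/m| ≤ κ`. -/
theorem el_abs_sub_avg_le {m : ℕ} (hm : 1 ≤ m) {x κ : ℝ} {a : ℕ → ℝ}
    (h : ∀ j ∈ Finset.range m, |x - a j| ≤ κ) :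
    |x - (∑ j ∈ Finset.range m, a j) / m| ≤ κ := by
  have hm' : (0 : ℝ) < m := by exact_mod_cast hm
  have : x - (∑ j ∈ Finset.range m, a j) / m = (∑ j ∈ Finset.range m, (x - a j)) / m := by
    rw [Finset.sum_sub_distrib, Finset.sum_const, Finset.card_range, nsmul_eq_mul]
    field_simp
  rw [this, abs_div, abs_of_pos hm', div_le_iff₀ hm']
  calc |∑ j ∈ Finset.range m, (x - a j)| ≤ ∑ j ∈ Finset.range m, |x - a j| := Finset.abs_sum_le_sum_abs _ _
    _ ≤ ∑ _j ∈ Finset.range m, κ := Finset.sum_le_sum h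
    _ = κ * m := by rw [Finset.sum_const, Finset.card_range, nsmul_eq_mul, mul_comm]

/-- Jensen for the square of an average: `((∑ a j)/m)² ≤ (∑ (a j)²)/m`. -/
theorem el_sq_avg_le {m : ℕ} (a : ℕ → ℝ) :
    ((∑ j ∈ Finset.range m, a j) / m) ^ 2 ≤ (∑ j ∈ Finset.range m, a j ^ 2) / m := by
  rcases Nat.eq_zero_or_pos m with rfl | hm
  · simp
  have hm' : (0 : ℝ) < m := by exact_mod_cast hm
  have key : (∑ j ∈ Finset.range m, a j) ^ 2 ≤ m * ∑ j ∈ Finset.range m, a j ^ 2 := by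
    have h := Finset.sum_mul_sq_le_sq_mul_sq (Finset.range m) (fun j ↦ a j) (fun _ ↦ (1 : ℝ))
    simpa [Finset.sum_const, Finset.card_range, mul_comm] using h
  rw [div_pow, div_le_div_iff₀ (by positivity) hm']
  calc (∑ j ∈ Finset.range m, a j) ^ 2 * m ≤ (m * ∑ j ∈ Finset.range m, a j ^ 2) * m := by gcongr
    _ = (∑ j ∈ Finset.range m, a j ^ 2) * (m : ℝ) ^ 2 := by ring

/-- AM–GM with an indicator: `|x| ≤ (t/2) x² + 1/(2t)` for `t > 0`. -/
theorem el_abs_le_sq_add {t : ℝ} (ht : 0 < t) (x : ℝ) : |x| ≤ t / 2 * x ^ 2 + 1 / (2 * t) := by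
  have hx : |x| ^ 2 = x ^ 2 := sq_abs x
  have key : t / 2 * x ^ 2 + 1 / (2 * t) - |x| = (t * |x| - 1) ^ 2 / (2 * t) := by
    field_simp
    rw [← hx]
    ring
  have h : 0 ≤ (t * |x| - 1) ^ 2 / (2 * t) := by positivity
  linarith

/-! ## The coupling estimate (abstract) -/

section Coupling

variable {Ω : Type*} [MeasurableSpace Ω]

/-- **Coupling estimate.**  If `Q` couples `P` with itself, `F, G` are square-integrable with second moments
`≤ B`, and off a set `Bad0` of `Q`-(outer) measure `≤ κ₁²/(2(4B+1))` the coupled difference `F(p.1) − G(p.2)` is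
`≤ κ₁` in absolute value, then `|∫ F dP − ∫ G dP| ≤ 2κ₁`.  (`Bad0` need not be measurable.) -/
theorem el_coupling_estimate' {P : Measure Ω} [IsProbabilityMeasure P] {Q : Measure (Ω × Ω)}
    {F G : Ω → ℝ} {B κ₁ : ℝ} {Bad0 : Set (Ω × Ω)}
    (hFm : Measurable F) (hGm : Measurable G) (hFi : Integrable F P) (hGi : Integrable G P)
    (hF2 : Integrable (fun ω ↦ F ω ^ 2) P) (hG2 : Integrable (fun ω ↦ G ω ^ 2) P)
    (hFB : ∫ ω, F ω ^ 2 ∂P ≤ B) (hGB : ∫ ω, G ω ^ 2 ∂P ≤ B) (hB : 0 ≤ B) (hκ₁ : 0 < κ₁)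
    (hQ1 : Q.map Prod.fst = P) (hQ2 : Q.map Prod.snd = P)
    (hBad : Q Bad0 ≤ ENNReal.ofReal (κ₁ ^ 2 / (2 * (4 * B + 1))))
    (hgood : ∀ p, p ∉ Bad0 → |F p.1 - G p.2| ≤ κ₁) :
    |∫ ω, F ω ∂P - ∫ ω, G ω ∂P| ≤ 2 * κ₁ := by
  -- `Q` is a probability measure
  haveI : IsProbabilityMeasure Q := by
    constructor
    have h := congrArg (fun μ : Measure Ω ↦ μ Set.univ) hQ1
    simp only [measure_univ] at h
    rwa [Measure.map_apply measurable_fst MeasurableSet.univ, Set.preimage_univ] at h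
  -- transport the integrals to `Q`
  have hF1 : ∫ ω, F ω ∂P = ∫ p, F p.1 ∂Q := by
    rw [← hQ1, integral_map measurable_fst.aemeasurable]
    rw [hQ1]; exact hFi.aestronglyMeasurable
  have hG1 : ∫ ω, G ω ∂P = ∫ p, G p.2 ∂Q := by
    rw [← hQ2, integral_map measurable_snd.aemeasurable]
    rw [hQ2]; exact hGi.aestronglyMeasurable
  -- integrability under `Q`
  have hiF : Integrable (fun p : Ω × Ω ↦ F p.1) Q := by
    have := (integrable_map_measure (μ := Q) (f := Prod.fst) (g := F)
      (by rw [hQ1]; exact hFi.aestronglyMeasurable) measurable_fst.aemeasurable).1 (by rw [hQ1]; exact hFi)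
    exact this
  have hiG : Integrable (fun p : Ω × Ω ↦ G p.2) Q := by
    have := (integrable_map_measure (μ := Q) (f := Prod.snd) (g := G)
      (by rw [hQ2]; exact hGi.aestronglyMeasurable) measurable_snd.aemeasurable).1 (by rw [hQ2]; exact hGi)
    exact this
  have hiF2 : Integrable (fun p : Ω × Ω ↦ F p.1 ^ 2) Q := by
    have := (integrable_map_measure (μ := Q) (f := Prod.fst) (g := fun ω ↦ F ω ^ 2)
      (by rw [hQ1]; exact hF2.aestronglyMeasurable) measurable_fst.aemeasurable).1 (by rw [hQ1]; exact hF2)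
    exact this
  have hiG2 : Integrable (fun p : Ω × Ω ↦ G p.2 ^ 2) Q := by
    have := (integrable_map_measure (μ := Q) (f := Prod.snd) (g := fun ω ↦ G ω ^ 2)
      (by rw [hQ2]; exact hG2.aestronglyMeasurable) measurable_snd.aemeasurable).1 (by rw [hQ2]; exact hG2)
    exact this
  have hEF2 : ∫ p, F p.1 ^ 2 ∂Q = ∫ ω, F ω ^ 2 ∂P := by
    rw [← hQ1, integral_map measurable_fst.aemeasurable]
    rw [hQ1]; exact hF2.aestronglyMeasurable
  have hEG2 : ∫ p, G p.2 ^ 2 ∂Q = ∫ ω, G ω ^ 2 ∂P := by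
    rw [← hQ2, integral_map measurable_snd.aemeasurable]
    rw [hQ2]; exact hG2.aestronglyMeasurable
  -- the difference and its second moment
  set D : Ω × Ω → ℝ := fun p ↦ F p.1 - G p.2 with hD
  have hDm : Measurable D := (hFm.comp measurable_fst).sub (hGm.comp measurable_snd)
  have hDi : Integrable D Q := hiF.sub hiG
  have hD2i : Integrable (fun p ↦ D p ^ 2) Q := by
    refine Integrable.mono' ((hiF2.const_mul 2).add (hiG2.const_mul 2)) (hDm.pow_const 2).aestronglyMeasurable
      (Eventually.of_forall fun p ↦ ?_)
    simp only [hD, Real.norm_eq_abs, abs_pow, sq_abs, Pi.add_apply]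
    nlinarith [sq_nonneg (F p.1 + G p.2)]
  have hD2 : ∫ p, D p ^ 2 ∂Q ≤ 4 * B := by
    calc ∫ p, D p ^ 2 ∂Q ≤ ∫ p, (2 * F p.1 ^ 2 + 2 * G p.2 ^ 2) ∂Q := by
          refine integral_mono hD2i ((hiF2.const_mul 2).add (hiG2.const_mul 2)) fun p ↦ ?_
          simp only [hD]
          nlinarith [sq_nonneg (F p.1 + G p.2)]
      _ = 2 * ∫ p, F p.1 ^ 2 ∂Q + 2 * ∫ p, G p.2 ^ 2 ∂Q := by
          rw [integral_add (hiF2.const_mul 2) (hiG2.const_mul 2), integral_const_mul, integral_const_mul]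
      _ ≤ 2 * B + 2 * B := by rw [hEF2, hEG2]; gcongr
      _ = 4 * B := by ring
  -- the measurable hull of the bad set
  set Bad : Set (Ω × Ω) := toMeasurable Q Bad0 with hBadDef
  have hBadm : MeasurableSet Bad := measurableSet_toMeasurable Q Bad0
  have hQBad : Q.real Bad ≤ κ₁ ^ 2 / (2 * (4 * B + 1)) := by
    rw [measureReal_def, hBadDef, measure_toMeasurable]
    exact ENNReal.toReal_le_of_le_ofReal (by positivity) hBad
  -- good part
  have hgoodBad : ∀ p ∈ Badᶜ, ‖|D p|‖ ≤ κ₁ := by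
    intro p hp
    rw [Real.norm_eq_abs, abs_abs]
    exact hgood p fun h ↦ hp (subset_toMeasurable Q Bad0 h)
  have hI1 : ∫ p in Badᶜ, |D p| ∂Q ≤ κ₁ := by
    have h := norm_setIntegral_le_of_norm_le_const (measure_lt_top Q Badᶜ) hgoodBad
    rw [Real.norm_eq_abs, abs_of_nonneg (integral_nonneg fun p ↦ abs_nonneg _)] at h
    calc ∫ p in Badᶜ, |D p| ∂Q ≤ κ₁ * Q.real Badᶜ := h
      _ ≤ κ₁ * 1 := by gcongr; exact measureReal_le_one
      _ = κ₁ := mul_one _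
  -- bad part: AM–GM
  set t : ℝ := κ₁ / (4 * B + 1) with ht
  have htpos : 0 < t := by positivity
  have hI2 : ∫ p in Bad, |D p| ∂Q ≤ κ₁ / 2 + κ₁ / 4 := by
    have hpt : ∀ p, |D p| ≤ t / 2 * D p ^ 2 + 1 / (2 * t) := fun p ↦ el_abs_le_sq_add htpos (D p)
    have hint : Integrable (fun p ↦ t / 2 * D p ^ 2 + 1 / (2 * t)) Q :=
      (hD2i.const_mul _).add (integrable_const _)
    calc ∫ p in Bad, |D p| ∂Q ≤ ∫ p in Bad, (t / 2 * D p ^ 2 + 1 / (2 * t)) ∂Q := by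
          exact setIntegral_mono_on hDi.abs.integrableOn hint.integrableOn hBadm fun p _ ↦ hpt p
      _ = t / 2 * ∫ p in Bad, D p ^ 2 ∂Q + Q.real Bad * (1 / (2 * t)) := by
          rw [integral_add (hD2i.const_mul _).integrableOn (integrable_const _).integrableOn,
            integral_const_mul, setIntegral_const, smul_eq_mul]
      _ ≤ t / 2 * (4 * B) + κ₁ ^ 2 / (2 * (4 * B + 1)) * (1 / (2 * t)) := by
          gcongr
          · exact (setIntegral_le_integral hD2i (Eventually.of_forall fun p ↦ sq_nonneg _)).trans hD2
      _ = κ₁ / 2 * (4 * B / (4 * B + 1)) + κ₁ / 4 := by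
          rw [ht]; field_simp; ring
      _ ≤ κ₁ / 2 * 1 + κ₁ / 4 := by
          gcongr
          rw [div_le_one (by positivity)]; linarith
      _ = κ₁ / 2 + κ₁ / 4 := by ring
  -- assemble
  rw [hF1, hG1, ← integral_sub hiF hiG]
  calc |∫ p, (F p.1 - G p.2) ∂Q| = |∫ p, D p ∂Q| := rfl
    _ ≤ ∫ p, |D p| ∂Q := abs_integral_le_integral_abs
    _ = ∫ p in Bad, |D p| ∂Q + ∫ p in Badᶜ, |D p| ∂Q := (integral_add_compl hBadm hDi.abs).symm
    _ ≤ (κ₁ / 2 + κ₁ / 4) + κ₁ := add_le_add hI2 hI1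
    _ ≤ 2 * κ₁ := by linarith

end Coupling

/-- **Coupling estimate** (registered sub-goal `el_coupling_estimate`, verbatim signature): see
`el_coupling_estimate'`. -/
theorem el_coupling_estimate : ∀ {Ω : Type*} [MeasurableSpace Ω] {P : MeasureTheory.Measure Ω} [MeasureTheory.IsProbabilityMeasure P] {Q : MeasureTheory.Measure (Ω × Ω)} {F G : Ω → ℝ} {B κ₁ : ℝ} {Bad0 : Set (Ω × Ω)}, Measurable F → Measurable G → MeasureTheory.Integrable F P → MeasureTheory.Integrable G P → MeasureTheory.Integrable (fun ω ↦ F ω ^ 2) P → MeasureTheory.Integrable (fun ω ↦ G ω ^ 2) P → ∫ ω, F ω ^ 2 ∂P ≤ B → ∫ ω, G ω ^ 2 ∂P ≤ B → 0 ≤ B → 0 < κ₁ → Q.map Prod.fst = P → Q.map Prod.snd = P → Q Bad0 ≤ ENNReal.ofReal (κ₁ ^ 2 / (2 * (4 * B + 1))) → (∀ p, p ∉ Bad0 → |F p.1 - G p.2| ≤ κ₁) → |∫ ω, F ω ∂P - ∫ ω, G ω ∂P| ≤ 2 * κ₁ :=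
  fun hFm hGm hFi hGi hF2 hG2 hFB hGB hB hκ₁ hQ1 hQ2 hBad hgood ↦
    el_coupling_estimate' hFm hGm hFi hGi hF2 hG2 hFB hGB hB hκ₁ hQ1 hQ2 hBad hgood


end Summit.CriticalPhenomena.CardyFormulaZ2.Cruxes.MagicFormulaT.LineSketch

end
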